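import Literature.IUT.HodgeArakelov.KummerPrimeStrips

/-!
# [IUTchII] Def 4.9 (vii): isomorphisms of the local data of `F^{⊢▶×μ}`- and `F^{⊢×μ}`-prime-strips

Owner file (abc-iut cell, layer L6; abc-iut-L6-t2; no re-typing of landed modules). S. Mochizuki,
*Inter-universal Teichmüller theory II*, kurims Dec-2020 manuscript, Def 4.9 (vii) p. 158: "A morphism of
`F^{⊢×}`-prime-strips (respectively, `F^{⊢×μ}`-prime-strips; `F^{⊢▶×μ}`-prime-strips) is defined to be a
collection of isomorphisms, indexed by `V`, between the various constituent objects of the prime-strips"; Def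
4.9 (vi): the local data at bad / good nonarchimedean / archimedean places. `KummerPrimeStrips.lean` (p405008,
frozen) typed those local data as the RECORDS `NonarchTriMuDatum`, `ArchTriMuDatum`, `LocalTriMuDatum` (and the
strips `FTriMuPrimeStrip`, `FVdashTriMuPrimeStrip`) WITHOUT a notion of isomorphism between them (the strip
isomorphism `FVdashTriMuIso` is stated over an abstract local relation). This file supplies the missing
per-place ISOMORPHISM TYPES, so that the strip categories required by the [IUTchIII] §1–§2 frame
(`Literature.IUT.LogThetaLattice.StripFrame`: `Fxm`, `Fvtxm`, `Fglxm` groupoids and the functors between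
them; bridge B10) can be built over the Def 4.9 records:

* `NonarchTriMuDatum.Iso D D'` — an isomorphism of monoids `e : O^▷(‡A) ⥲ O^▷(‡A')` intertwining the
  `‡G`-actions, carrying the splitting image onto the splitting image and the `×`- and `×μ`-Kummer structures
  (orbits of equivariant isomorphisms out of `O^×(‡G)`, `O^{×μ}(‡G)`) onto each other (`transportTimes`,
  `transportTimesMu` = composition with `e` on units, resp. units modulo torsion); `refl`/`symm`/`trans`;
* `NonarchTriMuDatum.MuIso D D'` — an isomorphism of the associated `×μ`-DATA only (`‡G ↷ O^{×μ}` with the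
  `×μ`-Kummer structure; the local datum of the `F^{⊢×μ}`-prime-strip of Def 4.9 (vi)/(vii)), and
  `Iso.toMuIso` ("passing to `O^{×μ}`");
* `ArchTriMuDatum.Iso` (monoid iso carrying the splitting, with an iso of the circles compatible with the
  Kummer projections `(‡D^⊢_w)^× ↠ O^{×μ_N}`) and `LocalTriMuDatum.Iso` (by type of place), each with
  `refl`/`symm`/`trans`.

Claim key `Mochizuki2012` DISPUTED (D-0012): definitions + functoriality bookkeeping over interfaces; nothing
here asserts a disputed claim.
-/

namespace Literature.IUT.HodgeArakelov

universe u v w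

/-! ### 0. Equivariant isomorphisms: extensionality and transport along an equivariant iso of targets -/

section Equivariant

variable {G : Type u} [Group G] {U : Type v} [CommGroup U] {V : Type w} [CommGroup V] {W : Type*} [CommGroup W]
  {ρ : G →* MulAut U} {σ : G →* MulAut V} {τ : G →* MulAut W}

/-- Two equivariant isomorphisms with the same underlying `MulEquiv` are equal. (bookkeeping). [cite: Mochizuki2012, Def 4.9 (vii) p.158] -/
theorem EquivariantIso.ext' {κ κ' : EquivariantIso ρ σ} (h : κ.toMulEquiv = κ'.toMulEquiv) : κ = κ' := by
  cases κ; cases κ'; cases h; rfl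

/-- Post-composition of an equivariant isomorphism `(U, ρ) ⥲ (V, σ)` with an equivariant isomorphism of groups
`f : (V, σ) ⥲ (W, τ)` ([IUTchII] Def 4.9 (i)/(vii): Kummer structures are transported along isomorphisms of the
data). [cite: Mochizuki2012, Def 4.9 (vii) p.158] -/
def EquivariantIso.postcomp (κ : EquivariantIso ρ σ) (f : V ≃* W) (hf : ∀ (g : G) (v : V), f (σ g v) = τ g (f v)) :
    EquivariantIso ρ τ where
  toMulEquiv := κ.toMulEquiv.trans f
  map_act g u := by
    rw [MulEquiv.trans_apply, κ.map_act, hf, MulEquiv.trans_apply]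

/-- Underlying isomorphism of a post-composition. (bookkeeping). [cite: Mochizuki2012, Def 4.9 (vii) p.158] -/
@[simp] theorem EquivariantIso.postcomp_toMulEquiv (κ : EquivariantIso ρ σ) (f : V ≃* W)
    (hf : ∀ (g : G) (v : V), f (σ g v) = τ g (f v)) :
    (κ.postcomp f hf).toMulEquiv = κ.toMulEquiv.trans f := rfl

end Equivariant

/-! ### 1. Nonarchimedean local data (Def 4.9 (iii), (iv)): isomorphisms -/

namespace NonarchTriMuDatum

variable {l : ℕ} {k : PlaceKind} {G : Type u} [Group G] {X : GroupTheoreticUnits.{u, w} G}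

/-- A monoid isomorphism intertwining the actions induces an EQUIVARIANT isomorphism on units
(`CoveringMonoid.unitsAct` = `Units.mapEquiv` of the action). [cite: Mochizuki2012, Def 4.9 (vii) p.158] -/
theorem unitsAct_mapEquiv (D D' : NonarchTriMuDatum.{u, v, w} l k G X) (e : D.O ≃* D'.O)
    (he : ∀ (g : G) (x : D.O), e (D.act g x) = D'.act g (e x)) (g : G) (u : (D.O)ˣ) :
    Units.mapEquiv e (D.covering.unitsAct g u) = D'.covering.unitsAct g (Units.mapEquiv e u) := by
  ext
  exact he g u

/-- The same on units modulo torsion. [cite: Mochizuki2012, Def 4.9 (vii) p.158] -/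
theorem unitsModTorsionAct_mapEquiv (D D' : NonarchTriMuDatum.{u, v, w} l k G X) (e : D.O ≃* D'.O)
    (he : ∀ (g : G) (x : D.O), e (D.act g x) = D'.act g (e x)) (g : G) (x : UnitsModTorsion D.O) :
    MulEquivModTorsion (Units.mapEquiv e) (D.covering.unitsModTorsionAct g x) =
      D'.covering.unitsModTorsionAct g (MulEquivModTorsion (Units.mapEquiv e) x) := by
  induction x using QuotientGroup.induction_on with
  | H u =>
    change MulEquivModTorsion (Units.mapEquiv e) (actionModTorsion D.covering.unitsAct g (QuotientGroup.mk u)) =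
      actionModTorsion D'.covering.unitsAct g (MulEquivModTorsion (Units.mapEquiv e) (QuotientGroup.mk u))
    rw [actionModTorsion_mk, mulEquivModTorsion_mk, mulEquivModTorsion_mk, actionModTorsion_mk,
      unitsAct_mapEquiv D D' e he]

/-- Transport of a `×`-Kummer isomorphism `κ : O^×(‡G) ⥲ O^×(‡A)` along `e : O^▷(‡A) ⥲ O^▷(‡A')` (equivariant):
`κ ↦ e|_units ∘ κ`. [cite: Mochizuki2012, Def 4.9 (vii) p.158] -/
def transportTimes (D D' : NonarchTriMuDatum.{u, v, w} l k G X) (e : D.O ≃* D'.O)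
    (he : ∀ (g : G) (x : D.O), e (D.act g x) = D'.act g (e x))
    (κ : EquivariantIso X.act D.covering.unitsAct) : EquivariantIso X.act D'.covering.unitsAct :=
  κ.postcomp (Units.mapEquiv e) (unitsAct_mapEquiv D D' e he)

/-- Transport of a `×μ`-Kummer isomorphism `κ : O^{×μ}(‡G) ⥲ O^{×μ}(‡A)` along `e` (equivariant): composition with
the isomorphism induced by `e` on units modulo torsion. [cite: Mochizuki2012, Def 4.9 (vii) p.158] -/
def transportTimesMu (D D' : NonarchTriMuDatum.{u, v, w} l k G X) (e : D.O ≃* D'.O)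
    (he : ∀ (g : G) (x : D.O), e (D.act g x) = D'.act g (e x))
    (κ : EquivariantIso (actionModTorsion X.act) D.covering.unitsModTorsionAct) :
    EquivariantIso (actionModTorsion X.act) D'.covering.unitsModTorsionAct :=
  κ.postcomp (MulEquivModTorsion (Units.mapEquiv e)) (unitsModTorsionAct_mapEquiv D D' e he)

/-- **An isomorphism of the nonarchimedean local data `‡F^{⊢▶×μ}_w ⥲ ‡F'^{⊢▶×μ}_w`** ([IUTchII] Def 4.9 (vii)
p. 158 "a collection of isomorphisms … between the various constituent objects"): an isomorphism of the
monoids `O^▷` intertwining the `‡G`-actions, carrying the splitting image onto the splitting image, and the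
`×`- and `×μ`-Kummer structures (orbits) onto each other. [cite: Mochizuki2012, Def 4.9 (vii) p.158] -/
structure Iso (D D' : NonarchTriMuDatum.{u, v, w} l k G X) : Type (max u v w) where
  /-- the isomorphism of monoids `O^▷(‡A) ⥲ O^▷(‡A')` -/
  e : D.O ≃* D'.O
  /-- it intertwines the `‡G`-actions -/
  map_act : ∀ (g : G) (x : D.O), e (D.act g x) = D'.act g (e x)
  /-- it carries the splitting image onto the splitting image -/
  map_splitting : D.splitting.map e.toMonoidHom = D'.splitting
  /-- it carries the `×`-Kummer structure onto the `×`-Kummer structure -/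
  mem_kummerTimes_iff : ∀ κ : EquivariantIso X.act D.covering.unitsAct,
    transportTimes D D' e map_act κ ∈ D'.kummerTimes.orbit ↔ κ ∈ D.kummerTimes.orbit
  /-- it carries the `×μ`-Kummer structure onto the `×μ`-Kummer structure -/
  mem_kummerTimesMu_iff : ∀ κ : EquivariantIso (actionModTorsion X.act) D.covering.unitsModTorsionAct,
    transportTimesMu D D' e map_act κ ∈ D'.kummerTimesMu.orbit ↔ κ ∈ D.kummerTimesMu.orbit

namespace Iso

variable {D D' D'' : NonarchTriMuDatum.{u, v, w} l k G X}

/-- An isomorphism of local data is determined by its underlying monoid isomorphism. (bookkeeping). [cite: Mochizuki2012, Def 4.9 (vii) p.158] -/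
theorem ext' {f f' : Iso D D'} (h : f.e = f'.e) : f = f' := by
  cases f; cases f'; cases h; rfl

/-- Transport along the identity is the identity. (bookkeeping). [cite: Mochizuki2012, Def 4.9 (vii) p.158] -/
theorem transportTimes_refl (κ : EquivariantIso X.act D.covering.unitsAct) :
    transportTimes D D (MulEquiv.refl _) (fun _ _ => rfl) κ = κ :=
  EquivariantIso.ext' (MulEquiv.ext fun _ => Units.ext rfl)

/-- Transport along the identity is the identity (`×μ`). (bookkeeping). [cite: Mochizuki2012, Def 4.9 (vii) p.158] -/
theorem transportTimesMu_refl (κ : EquivariantIso (actionModTorsion X.act) D.covering.unitsModTorsionAct) :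
    transportTimesMu D D (MulEquiv.refl _) (fun _ _ => rfl) κ = κ := by
  refine EquivariantIso.ext' (MulEquiv.ext fun x => ?_)
  change MulEquivModTorsion (Units.mapEquiv (MulEquiv.refl _)) (κ.toMulEquiv x) = κ.toMulEquiv x
  induction κ.toMulEquiv x using QuotientGroup.induction_on with
  | H u => rw [mulEquivModTorsion_mk]; rfl

/-- **Identity isomorphism** of a local datum. [cite: Mochizuki2012, Def 4.9 (vii) p.158] -/
def refl (D : NonarchTriMuDatum.{u, v, w} l k G X) : Iso D D where
  e := MulEquiv.refl _
  map_act _ _ := rfl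
  map_splitting := by
    ext x; simp
  mem_kummerTimes_iff κ := by rw [transportTimes_refl]
  mem_kummerTimesMu_iff κ := by rw [transportTimesMu_refl]

/-- Transport along a composite is the composite of the transports. (bookkeeping). [cite: Mochizuki2012, Def 4.9 (vii) p.158] -/
theorem transportTimes_trans (f : Iso D D') (f' : Iso D' D'') (κ : EquivariantIso X.act D.covering.unitsAct)
    (he : ∀ (g : G) (x : D.O), (f.e.trans f'.e) (D.act g x) = D''.act g ((f.e.trans f'.e) x)) :
    transportTimes D D'' (f.e.trans f'.e) he κ =
      transportTimes D' D'' f'.e f'.map_act (transportTimes D D' f.e f.map_act κ) :=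
  EquivariantIso.ext' (MulEquiv.ext fun _ => Units.ext rfl)

/-- Transport along a composite is the composite of the transports (`×μ`). (bookkeeping). [cite: Mochizuki2012, Def 4.9 (vii) p.158] -/
theorem transportTimesMu_trans (f : Iso D D') (f' : Iso D' D'')
    (κ : EquivariantIso (actionModTorsion X.act) D.covering.unitsModTorsionAct)
    (he : ∀ (g : G) (x : D.O), (f.e.trans f'.e) (D.act g x) = D''.act g ((f.e.trans f'.e) x)) :
    transportTimesMu D D'' (f.e.trans f'.e) he κ =
      transportTimesMu D' D'' f'.e f'.map_act (transportTimesMu D D' f.e f.map_act κ) := by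
  refine EquivariantIso.ext' (MulEquiv.ext fun x => ?_)
  change MulEquivModTorsion (Units.mapEquiv (f.e.trans f'.e)) (κ.toMulEquiv x) =
    MulEquivModTorsion (Units.mapEquiv f'.e) (MulEquivModTorsion (Units.mapEquiv f.e) (κ.toMulEquiv x))
  induction κ.toMulEquiv x using QuotientGroup.induction_on with
  | H u => simp only [mulEquivModTorsion_mk]; rfl

/-- **Composite** of isomorphisms of local data. [cite: Mochizuki2012, Def 4.9 (vii) p.158] -/
def trans (f : Iso D D') (f' : Iso D' D'') : Iso D D'' where
  e := f.e.trans f'.e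
  map_act g x := by rw [MulEquiv.trans_apply, f.map_act, f'.map_act, MulEquiv.trans_apply]
  map_splitting := by
    have : (f.e.trans f'.e).toMonoidHom = f'.e.toMonoidHom.comp f.e.toMonoidHom := rfl
    rw [this, ← Submonoid.map_map, f.map_splitting, f'.map_splitting]
  mem_kummerTimes_iff κ := by
    rw [transportTimes_trans f f' κ, f'.mem_kummerTimes_iff, f.mem_kummerTimes_iff]
  mem_kummerTimesMu_iff κ := by
    rw [transportTimesMu_trans f f' κ, f'.mem_kummerTimesMu_iff, f.mem_kummerTimesMu_iff]

/-- Transport along `e.symm` undoes transport along `e`. (bookkeeping). [cite: Mochizuki2012, Def 4.9 (vii) p.158] -/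
theorem transportTimes_symm_apply (f : Iso D D') (κ : EquivariantIso X.act D'.covering.unitsAct)
    (he : ∀ (g : G) (y : D'.O), f.e.symm (D'.act g y) = D.act g (f.e.symm y)) :
    transportTimes D D' f.e f.map_act (transportTimes D' D f.e.symm he κ) = κ :=
  EquivariantIso.ext' (MulEquiv.ext fun u => Units.ext (by simp [transportTimes]))

/-- Transport along `e.symm` undoes transport along `e` (`×μ`). (bookkeeping). [cite: Mochizuki2012, Def 4.9 (vii) p.158] -/
theorem transportTimesMu_symm_apply (f : Iso D D')
    (κ : EquivariantIso (actionModTorsion X.act) D'.covering.unitsModTorsionAct)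
    (he : ∀ (g : G) (y : D'.O), f.e.symm (D'.act g y) = D.act g (f.e.symm y)) :
    transportTimesMu D D' f.e f.map_act (transportTimesMu D' D f.e.symm he κ) = κ := by
  refine EquivariantIso.ext' (MulEquiv.ext fun x => ?_)
  change MulEquivModTorsion (Units.mapEquiv f.e) (MulEquivModTorsion (Units.mapEquiv f.e.symm) (κ.toMulEquiv x)) =
    κ.toMulEquiv x
  induction κ.toMulEquiv x using QuotientGroup.induction_on with
  | H u =>
    simp only [mulEquivModTorsion_mk]
    congr 1
    ext
    simp

/-- Conversely, transport along `e` then `e.symm`. (bookkeeping). [cite: Mochizuki2012, Def 4.9 (vii) p.158] -/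
theorem transportTimes_symm_apply' (f : Iso D D') (κ : EquivariantIso X.act D.covering.unitsAct)
    (he : ∀ (g : G) (y : D'.O), f.e.symm (D'.act g y) = D.act g (f.e.symm y)) :
    transportTimes D' D f.e.symm he (transportTimes D D' f.e f.map_act κ) = κ :=
  EquivariantIso.ext' (MulEquiv.ext fun u => Units.ext (by simp [transportTimes]))

/-- Conversely (`×μ`). (bookkeeping). [cite: Mochizuki2012, Def 4.9 (vii) p.158] -/
theorem transportTimesMu_symm_apply' (f : Iso D D')
    (κ : EquivariantIso (actionModTorsion X.act) D.covering.unitsModTorsionAct)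
    (he : ∀ (g : G) (y : D'.O), f.e.symm (D'.act g y) = D.act g (f.e.symm y)) :
    transportTimesMu D' D f.e.symm he (transportTimesMu D D' f.e f.map_act κ) = κ := by
  refine EquivariantIso.ext' (MulEquiv.ext fun x => ?_)
  change MulEquivModTorsion (Units.mapEquiv f.e.symm) (MulEquivModTorsion (Units.mapEquiv f.e) (κ.toMulEquiv x)) =
    κ.toMulEquiv x
  induction κ.toMulEquiv x using QuotientGroup.induction_on with
  | H u =>
    simp only [mulEquivModTorsion_mk]
    congr 1
    ext
    simp

/-- **Inverse** of an isomorphism of local data. [cite: Mochizuki2012, Def 4.9 (vii) p.158] -/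
def symm (f : Iso D D') : Iso D' D where
  e := f.e.symm
  map_act g y := by
    apply f.e.injective
    rw [MulEquiv.apply_symm_apply, f.map_act, MulEquiv.apply_symm_apply]
  map_splitting := by
    rw [← f.map_splitting, Submonoid.map_map]
    have : f.e.symm.toMonoidHom.comp f.e.toMonoidHom = MonoidHom.id _ := by
      ext x; simp
    rw [this, Submonoid.map_id]
  mem_kummerTimes_iff κ := by
    have he : ∀ (g : G) (y : D'.O), f.e.symm (D'.act g y) = D.act g (f.e.symm y) := fun g y => by
      apply f.e.injective; rw [MulEquiv.apply_symm_apply, f.map_act, MulEquiv.apply_symm_apply]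
    constructor
    · intro h
      have := (f.mem_kummerTimes_iff (transportTimes D' D f.e.symm he κ)).mpr h
      rwa [transportTimes_symm_apply f κ he] at this
    · intro h
      have := f.mem_kummerTimes_iff (transportTimes D' D f.e.symm he κ)
      rw [transportTimes_symm_apply f κ he] at this
      exact this.mp h
  mem_kummerTimesMu_iff κ := by
    have he : ∀ (g : G) (y : D'.O), f.e.symm (D'.act g y) = D.act g (f.e.symm y) := fun g y => by
      apply f.e.injective; rw [MulEquiv.apply_symm_apply, f.map_act, MulEquiv.apply_symm_apply]
    constructor
    · intro h
      have := (f.mem_kummerTimesMu_iff (transportTimesMu D' D f.e.symm he κ)).mpr h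
      rwa [transportTimesMu_symm_apply f κ he] at this
    · intro h
      have := f.mem_kummerTimesMu_iff (transportTimesMu D' D f.e.symm he κ)
      rw [transportTimesMu_symm_apply f κ he] at this
      exact this.mp h

/-- `refl ≫ f = f`. (bookkeeping). [cite: Mochizuki2012, Def 4.9 (vii) p.158] -/
theorem refl_trans (f : Iso D D') : (refl D).trans f = f := ext' (MulEquiv.ext fun _ => rfl)

/-- `f ≫ refl = f`. (bookkeeping). [cite: Mochizuki2012, Def 4.9 (vii) p.158] -/
theorem trans_refl (f : Iso D D') : f.trans (refl D') = f := ext' (MulEquiv.ext fun _ => rfl)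

/-- Associativity. (bookkeeping). [cite: Mochizuki2012, Def 4.9 (vii) p.158] -/
theorem trans_assoc {D''' : NonarchTriMuDatum.{u, v, w} l k G X} (f : Iso D D') (f' : Iso D' D'')
    (f'' : Iso D'' D''') : (f.trans f').trans f'' = f.trans (f'.trans f'') := ext' (MulEquiv.ext fun _ => rfl)

/-- `f ≫ f⁻¹ = refl`. (bookkeeping). [cite: Mochizuki2012, Def 4.9 (vii) p.158] -/
theorem trans_symm (f : Iso D D') : f.trans f.symm = refl D :=
  ext' (MulEquiv.ext fun x => by simp [trans, symm, refl])

/-- `f⁻¹ ≫ f = refl`. (bookkeeping). [cite: Mochizuki2012, Def 4.9 (vii) p.158] -/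
theorem symm_trans (f : Iso D D') : f.symm.trans f = refl D' :=
  ext' (MulEquiv.ext fun x => by simp [trans, symm, refl])

end Iso

/-! ### The associated `×μ`-data and its isomorphisms (Def 4.9 (vi)/(vii): `F^{⊢×μ}`) -/

/-- **An isomorphism of the `×μ`-data** `(‡G ↷ O^{×μ}(‡A), ‡κ^{⊢×μ}_w) ⥲ (‡G ↷ O^{×μ}(‡A'), ‡κ'^{⊢×μ}_w)` — the
local datum of the `F^{⊢×μ}`-prime-strip determined by `‡F^{⊢▶×μ}_w` ([IUTchII] Def 4.9 (vi) "the pair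
`‡F^{⊢×μ}_v`", (vii) "a collection of isomorphisms"): an equivariant isomorphism of the unit groups modulo torsion
carrying the `×μ`-Kummer structure onto the `×μ`-Kummer structure. [cite: Mochizuki2012, Def 4.9 (vii) p.158] -/
structure MuIso (D D' : NonarchTriMuDatum.{u, v, w} l k G X) : Type (max u v w) where
  /-- the isomorphism `O^{×μ}(‡A) ⥲ O^{×μ}(‡A')` -/
  eMu : UnitsModTorsion D.O ≃* UnitsModTorsion D'.O
  /-- equivariance -/
  map_act : ∀ (g : G) (x : UnitsModTorsion D.O),
    eMu (D.covering.unitsModTorsionAct g x) = D'.covering.unitsModTorsionAct g (eMu x)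
  /-- the `×μ`-Kummer structures correspond -/
  mem_kummerTimesMu_iff : ∀ κ : EquivariantIso (actionModTorsion X.act) D.covering.unitsModTorsionAct,
    κ.postcomp eMu map_act ∈ D'.kummerTimesMu.orbit ↔ κ ∈ D.kummerTimesMu.orbit

namespace MuIso

variable {D D' D'' : NonarchTriMuDatum.{u, v, w} l k G X}

/-- A `×μ`-isomorphism is determined by its underlying group isomorphism. (bookkeeping). [cite: Mochizuki2012, Def 4.9 (vii) p.158] -/
theorem ext' {f f' : MuIso D D'} (h : f.eMu = f'.eMu) : f = f' := by
  cases f; cases f'; cases h; rfl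

/-- Identity. [cite: Mochizuki2012, Def 4.9 (vii) p.158] -/
def refl (D : NonarchTriMuDatum.{u, v, w} l k G X) : MuIso D D where
  eMu := MulEquiv.refl _
  map_act _ _ := rfl
  mem_kummerTimesMu_iff κ := by
    have : κ.postcomp (MulEquiv.refl _) (fun _ _ => rfl) = κ := EquivariantIso.ext' (MulEquiv.ext fun _ => rfl)
    rw [this]

/-- Composite. [cite: Mochizuki2012, Def 4.9 (vii) p.158] -/
def trans (f : MuIso D D') (f' : MuIso D' D'') : MuIso D D'' where
  eMu := f.eMu.trans f'.eMu
  map_act g x := by rw [MulEquiv.trans_apply, f.map_act, f'.map_act, MulEquiv.trans_apply]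
  mem_kummerTimesMu_iff κ := by
    have : κ.postcomp (f.eMu.trans f'.eMu)
        (fun g x => by rw [MulEquiv.trans_apply, f.map_act, f'.map_act, MulEquiv.trans_apply]) =
        (κ.postcomp f.eMu f.map_act).postcomp f'.eMu f'.map_act :=
      EquivariantIso.ext' (MulEquiv.ext fun _ => rfl)
    rw [this, f'.mem_kummerTimesMu_iff, f.mem_kummerTimesMu_iff]

/-- Inverse. [cite: Mochizuki2012, Def 4.9 (vii) p.158] -/
def symm (f : MuIso D D') : MuIso D' D where
  eMu := f.eMu.symm
  map_act g y := by
    apply f.eMu.injective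
    rw [MulEquiv.apply_symm_apply, f.map_act, MulEquiv.apply_symm_apply]
  mem_kummerTimesMu_iff κ := by
    have he : ∀ (g : G) (y : UnitsModTorsion D'.O),
        f.eMu.symm (D'.covering.unitsModTorsionAct g y) = D.covering.unitsModTorsionAct g (f.eMu.symm y) :=
      fun g y => by
        apply f.eMu.injective; rw [MulEquiv.apply_symm_apply, f.map_act, MulEquiv.apply_symm_apply]
    have hback : (κ.postcomp f.eMu.symm he).postcomp f.eMu f.map_act = κ :=
      EquivariantIso.ext' (MulEquiv.ext fun x => by simp)
    constructor
    · intro h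
      have := (f.mem_kummerTimesMu_iff (κ.postcomp f.eMu.symm he)).mpr h
      rwa [hback] at this
    · intro h
      have := f.mem_kummerTimesMu_iff (κ.postcomp f.eMu.symm he)
      rw [hback] at this
      exact this.mp h

/-- `refl ≫ f = f`. (bookkeeping). [cite: Mochizuki2012, Def 4.9 (vii) p.158] -/
theorem refl_trans (f : MuIso D D') : (refl D).trans f = f := ext' (MulEquiv.ext fun _ => rfl)

/-- `f ≫ refl = f`. (bookkeeping). [cite: Mochizuki2012, Def 4.9 (vii) p.158] -/
theorem trans_refl (f : MuIso D D') : f.trans (refl D') = f := ext' (MulEquiv.ext fun _ => rfl)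

/-- Associativity. (bookkeeping). [cite: Mochizuki2012, Def 4.9 (vii) p.158] -/
theorem trans_assoc {D''' : NonarchTriMuDatum.{u, v, w} l k G X} (f : MuIso D D') (f' : MuIso D' D'')
    (f'' : MuIso D'' D''') : (f.trans f').trans f'' = f.trans (f'.trans f'') := ext' (MulEquiv.ext fun _ => rfl)

/-- `f ≫ f⁻¹ = refl`. (bookkeeping). [cite: Mochizuki2012, Def 4.9 (vii) p.158] -/
theorem trans_symm (f : MuIso D D') : f.trans f.symm = refl D :=
  ext' (MulEquiv.ext fun x => by simp [trans, symm, refl])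

/-- `f⁻¹ ≫ f = refl`. (bookkeeping). [cite: Mochizuki2012, Def 4.9 (vii) p.158] -/
theorem symm_trans (f : MuIso D D') : f.symm.trans f = refl D' :=
  ext' (MulEquiv.ext fun x => by simp [trans, symm, refl])

end MuIso

/-- **"Passing to `O^{×μ}`"** ([IUTchII] Def 4.9 (vi)–(vii): the `F^{⊢×μ}`-prime-strip determined by an
`F^{⊢▶×μ}`-prime-strip; on morphisms): an isomorphism of the full local data induces an isomorphism of the
`×μ`-data. [cite: Mochizuki2012, Def 4.9 (vii) p.158] -/
def Iso.toMuIso {D D' : NonarchTriMuDatum.{u, v, w} l k G X} (f : Iso D D') : MuIso D D' where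
  eMu := MulEquivModTorsion (Units.mapEquiv f.e)
  map_act := unitsModTorsionAct_mapEquiv D D' f.e f.map_act
  mem_kummerTimesMu_iff := f.mem_kummerTimesMu_iff

/-- `toMuIso` of the identity is the identity. (bookkeeping). [cite: Mochizuki2012, Def 4.9 (vii) p.158] -/
theorem Iso.toMuIso_refl (D : NonarchTriMuDatum.{u, v, w} l k G X) : (Iso.refl D).toMuIso = MuIso.refl D := by
  refine MuIso.ext' (MulEquiv.ext fun x => ?_)
  change MulEquivModTorsion (Units.mapEquiv (MulEquiv.refl _)) x = x
  induction x using QuotientGroup.induction_on with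
  | H u => rw [mulEquivModTorsion_mk]; rfl

/-- `toMuIso` is compatible with composition. (bookkeeping). [cite: Mochizuki2012, Def 4.9 (vii) p.158] -/
theorem Iso.toMuIso_trans {D D' D'' : NonarchTriMuDatum.{u, v, w} l k G X} (f : Iso D D') (f' : Iso D' D'') :
    (f.trans f').toMuIso = f.toMuIso.trans f'.toMuIso := by
  refine MuIso.ext' (MulEquiv.ext fun x => ?_)
  change MulEquivModTorsion (Units.mapEquiv (f.e.trans f'.e)) x =
    MulEquivModTorsion (Units.mapEquiv f'.e) (MulEquivModTorsion (Units.mapEquiv f.e) x)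
  induction x using QuotientGroup.induction_on with
  | H u => simp only [mulEquivModTorsion_mk]; rfl

end NonarchTriMuDatum

end Literature.IUT.HodgeArakelov
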